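import Summits.Ventures.HodgeRepro2.T5InertPlaceCompletion
import Summits.Ventures.HodgeRepro2.T5RamifiedQuadraticDictionary
import Summits.Ventures.HodgeRepro2.T5AdicCompletionConductor
import Summits.Ventures.HodgeRepro2.T5AdicCompletionNormSurjective

/-!
# T5InertGlobalToLocal — the local degree formula `[L_w : K_v] = e(w/v) · f(w/v)` on Mathlib's
completions, and «inert» passed from the number fields to the local fields

Tier-5 kernel support (N3, the inert places) — p8, gen 15.  §8(d): uses an L-value-free
non-vanishing device: NO.

Carrier: `K ⊆ L` number fields, `v` a finite place of `K`, `w ∣ v` a finite place of `L`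
(`[w.asIdeal.LiesOver v.asIdeal]`), `Kv := v.adicCompletion K`, `Lw := w.adicCompletion L`,
`O_Kv`, `O_Lw` their valuation rings, with the continuous algebra `Kv → Lw` and the algebra
`O_Kv → O_Lw` of `T5AdicCompletionMap` / `T5ContinuousValuationExtension` (consumed by instance
search through the import of `T5InertPlaceCompletion`).

What is proved (all in the vocabulary of Mathlib's `Ideal.ramificationIdx'` / `Ideal.inertiaDeg'`
of the GLOBAL primes `v.asIdeal`, `w.asIdeal`):
* `ramificationIdx'_maximalIdeal_eq` — the local ramification index of the pair `O_Kv ⊆ O_Lw` is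
  the global `e(w/v)` (Mathlib's `valuation_liesOver` on a global uniformiser against the local
  factorisation `ϖ = u · π^e` of `T5ContinuousValuationExtension`);
* `inertiaDeg'_maximalIdeal_eq` — the local residue degree is the global `f(w/v)` (the residue
  fields of the completions are the global residue fields, `T5AdicCompletionResidueField`, and the
  identifications commute with the algebra maps);
* `finrank_adicCompletion_eq_mul` — **`[L_w : K_v] = e(w/v) · f(w/v)`** (the local fundamental
  identity of `T5RamifiedQuadraticDictionary` on the DVR pair `O_Kv ⊆ O_Lw`, read through the two
  bridges);
* the inert quadratic case `e(w/v) = 1`, `f(w/v) = 2`: `[L_w : K_v] = 2`, every uniformiser of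
  `O_Kv` stays a uniformiser of `O_Lw`, and the hypotheses of the inert-place package
  `T5InertPlaceCompletion` are discharged from these two global numbers
  (`map_maximalIdeal_integralClosure_eq_of_inert`, `isGalois_adicCompletion_of_inert`,
  `exists_algEquiv_ne_one_of_inert`).

Nothing here asserts that the datum's `(E_v, F_v)` is such a pair, nor which place is inert:
those remain the record's (N3's) identifications.
-/

namespace Summit.Ventures.HodgeRepro2.T5InertGlobalToLocal

open IsDedekindDomain HeightOneSpectrum NumberField

variable {K : Type*} [Field K] [NumberField K] (v : HeightOneSpectrum (RingOfIntegers K))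
variable {L : Type*} [Field L] [NumberField L] [Algebra K L]
  (w : HeightOneSpectrum (RingOfIntegers L)) [w.asIdeal.LiesOver v.asIdeal]

section Transport

/-- The algebra map `O_Kv → O_Lw`, read in `Lw`, is the algebra map `Kv → Lw` on the underlying
element (the two scalar towers of `T5ContinuousValuationExtension`). -/
theorem coe_algebraMap_integers (ϖ : v.adicCompletionIntegers K) :
    ((algebraMap (v.adicCompletionIntegers K) (w.adicCompletionIntegers L) ϖ :
      w.adicCompletionIntegers L) : w.adicCompletion L) =
      algebraMap (v.adicCompletion K) (w.adicCompletion L) (ϖ : v.adicCompletion K) := by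
  change algebraMap (w.adicCompletionIntegers L) (w.adicCompletion L)
    (algebraMap (v.adicCompletionIntegers K) (w.adicCompletionIntegers L) ϖ) =
    algebraMap (v.adicCompletion K) (w.adicCompletion L)
      (algebraMap (v.adicCompletionIntegers K) (v.adicCompletion K) ϖ)
  rw [← IsScalarTower.algebraMap_apply, ← IsScalarTower.algebraMap_apply]

/-- The valuation on `Lw` of the image of a global element `x ∈ K` is `v(x)^{e(w/v)}`
(Mathlib's `valuation_liesOver`, transported to the completions). -/
theorem val_algebraMap_of_global (x : K) :
    Valued.v (algebraMap (v.adicCompletion K) (w.adicCompletion L)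
      (algebraMap K (v.adicCompletion K) x)) =
      (v.valuation K x) ^ v.asIdeal.ramificationIdx' w.asIdeal := by
  rw [← IsScalarTower.algebraMap_apply, IsScalarTower.algebraMap_apply K L (w.adicCompletion L),
    valuation_liesOver L v w x]
  exact valuedAdicCompletion_eq_valuation' w (algebraMap K L x)

/-- The square `O_K → O_Kv → O_Lw` / `O_K → O_L → O_Lw` commutes. -/
theorem algebraMap_integers_global (x : 𝓞 K) :
    algebraMap (v.adicCompletionIntegers K) (w.adicCompletionIntegers L)
      (algebraMap (𝓞 K) (v.adicCompletionIntegers K) x) =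
    algebraMap (𝓞 L) (w.adicCompletionIntegers L) (algebraMap (𝓞 K) (𝓞 L) x) := by
  apply Subtype.ext
  rw [coe_algebraMap_integers]
  change algebraMap (v.adicCompletion K) (w.adicCompletion L)
      (algebraMap (𝓞 K) (v.adicCompletion K) x) =
    algebraMap (𝓞 L) (w.adicCompletion L) (algebraMap (𝓞 K) (𝓞 L) x)
  rw [IsScalarTower.algebraMap_apply (𝓞 K) K (v.adicCompletion K),
    ← IsScalarTower.algebraMap_apply K (v.adicCompletion K) (w.adicCompletion L),
    IsScalarTower.algebraMap_apply K L (w.adicCompletion L),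
    IsScalarTower.algebraMap_apply (𝓞 L) L (w.adicCompletion L),
    ← IsScalarTower.algebraMap_apply (𝓞 K) (𝓞 L) L,
    IsScalarTower.algebraMap_apply (𝓞 K) K L]

/-- The valuation on `Kv` of the image of a global integer is its `v`-adic valuation. -/
theorem val_coe_algebraMap_global (x : 𝓞 K) :
    Valued.v ((algebraMap (𝓞 K) (v.adicCompletionIntegers K) x :
      v.adicCompletionIntegers K) : v.adicCompletion K) = v.intValuation x := by
  change Valued.v (algebraMap (𝓞 K) (v.adicCompletion K) x) = _
  rw [IsScalarTower.algebraMap_apply (𝓞 K) K (v.adicCompletion K)]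
  exact (valuedAdicCompletion_eq_valuation' v (algebraMap (𝓞 K) K x)).trans
    (valuation_of_algebraMap v x)

/-- A global uniformiser of `v` (an integer of `v`-adic valuation `exp(-1)`) is a uniformiser of
`O_Kv` (`T5AdicCompletionConductor.irreducible_iff_val_eq_exp_neg_one`). -/
theorem irreducible_algebraMap_global (π₀ : 𝓞 K)
    (hπ₀ : v.intValuation π₀ = WithZero.exp (-1)) :
    Irreducible (algebraMap (𝓞 K) (v.adicCompletionIntegers K) π₀) :=
  (T5AdicCompletionConductor.irreducible_iff_val_eq_exp_neg_one v _).2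
    ((val_coe_algebraMap_global v π₀).trans hπ₀)

/-- The valuation on `Lw` of the image of a global integer is `v(x)^{e(w/v)}`. -/
theorem val_coe_algebraMap_global_adicCompletion (x : 𝓞 K) :
    Valued.v (((algebraMap (v.adicCompletionIntegers K) (w.adicCompletionIntegers L)
      (algebraMap (𝓞 K) (v.adicCompletionIntegers K) x) : w.adicCompletionIntegers L) :
        w.adicCompletion L)) =
      (v.intValuation x) ^ v.asIdeal.ramificationIdx' w.asIdeal := by
  rw [coe_algebraMap_integers]
  change Valued.v (algebraMap (v.adicCompletion K) (w.adicCompletion L)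
    (algebraMap (𝓞 K) (v.adicCompletion K) x)) = _
  rw [IsScalarTower.algebraMap_apply (𝓞 K) K (v.adicCompletion K), val_algebraMap_of_global,
    valuation_of_algebraMap]

end Transport

section RamificationIndex

/-- THE RAMIFICATION BRIDGE, uniformiser form: for `π₀` a global uniformiser of `v` and `π` any
uniformiser of `O_Lw`, the local ramification index `(ϖ).ramificationIdx' (π)` of
`T5ContinuousValuationExtension` (with `ϖ` the image of `π₀`) is the global `e(w/v)`:
compare `v_w(ϖ) = exp(-e_loc)` from `ϖ = u · π^{e_loc}` with `v_w(ϖ) = exp(-1)^{e(w/v)}`. -/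
theorem ramificationIdx'_span_eq (π₀ : 𝓞 K) (hπ₀ : v.intValuation π₀ = WithZero.exp (-1))
    (π : w.adicCompletionIntegers L) (hπ : Irreducible π) :
    (Ideal.span {algebraMap (𝓞 K) (v.adicCompletionIntegers K) π₀}).ramificationIdx'
      (Ideal.span {π}) = v.asIdeal.ramificationIdx' w.asIdeal := by
  have hϖ := irreducible_algebraMap_global v π₀ hπ₀
  obtain ⟨u, hu⟩ := T5ContinuousValuationExtension.exists_unit_algebraMap_eq_mul_pow
    (algebraMap (𝓞 K) (v.adicCompletionIntegers K) π₀) hϖ.ne_zero π hπ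
  have h1 := val_coe_algebraMap_global_adicCompletion v w π₀
  rw [hu, hπ₀] at h1
  have h2 : Valued.v (((u : w.adicCompletionIntegers L) * π ^
      (Ideal.span {algebraMap (𝓞 K) (v.adicCompletionIntegers K) π₀}).ramificationIdx'
        (Ideal.span {π}) : w.adicCompletionIntegers L) : w.adicCompletion L) =
      WithZero.exp (-1) ^ (Ideal.span {algebraMap (𝓞 K) (v.adicCompletionIntegers K) π₀}).ramificationIdx'
        (Ideal.span {π}) := by
    rw [Subring.coe_mul, SubmonoidClass.coe_pow, map_mul, map_pow,
      T5AdicCompletionNormSurjective.val_coe_units_eq_one w u, one_mul,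
      (T5AdicCompletionConductor.irreducible_iff_val_eq_exp_neg_one w π).1 hπ]
  rw [h2] at h1
  exact pow_right_injective₀ (by simp) (by simp) h1

/-- THE RAMIFICATION BRIDGE, maximal-ideal form: the ramification index of the DVR pair
`O_Kv ⊆ O_Lw` is the global `e(w/v)`. -/
theorem ramificationIdx'_maximalIdeal_eq :
    (IsLocalRing.maximalIdeal (v.adicCompletionIntegers K)).ramificationIdx'
      (IsLocalRing.maximalIdeal (w.adicCompletionIntegers L)) =
      v.asIdeal.ramificationIdx' w.asIdeal := by
  obtain ⟨π₀, hπ₀⟩ := v.intValuation_exists_uniformizer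
  obtain ⟨π, hπ⟩ := IsDiscreteValuationRing.exists_irreducible (w.adicCompletionIntegers L)
  rw [(irreducible_algebraMap_global v π₀ hπ₀).maximalIdeal_eq, hπ.maximalIdeal_eq]
  exact ramificationIdx'_span_eq v w π₀ hπ₀ π hπ

end RamificationIndex

section InertiaDegree

/-- THE RESIDUE BRIDGE: the residue degree of the completions is the global `f(w/v)` — the residue
fields of `O_Kv`, `O_Lw` are the global residue fields (`T5AdicCompletionResidueField`) and the two
identifications commute with the algebra maps (`algebraMap_integers_global`). -/
theorem finrank_residueField_eq_inertiaDeg' :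
    Module.finrank (IsLocalRing.ResidueField (v.adicCompletionIntegers K))
      (IsLocalRing.ResidueField (w.adicCompletionIntegers L)) =
      v.asIdeal.inertiaDeg' w.asIdeal := by
  rw [Ideal.inertiaDeg'_algebraMap]
  symm
  refine Algebra.finrank_eq_of_equiv_equiv
    (T5AdicCompletionResidueField.quotientEquivResidueField v)
    (T5AdicCompletionResidueField.quotientEquivResidueField w) ?_
  refine Ideal.Quotient.ringHom_ext (RingHom.ext fun x => ?_)
  change algebraMap (IsLocalRing.ResidueField (v.adicCompletionIntegers K))
      (IsLocalRing.ResidueField (w.adicCompletionIntegers L))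
      (IsLocalRing.residue _ (algebraMap (𝓞 K) (v.adicCompletionIntegers K) x)) =
    IsLocalRing.residue _ (algebraMap (𝓞 L) (w.adicCompletionIntegers L)
      (algebraMap (𝓞 K) (𝓞 L) x))
  rw [IsLocalRing.ResidueField.algebraMap_residue, algebraMap_integers_global]

/-- The local inertia degree `(ϖ).inertiaDeg' (π)` of `T5RamifiedQuadraticDictionary` is the
residue degree of the completions. -/
theorem inertiaDeg'_span_eq (ϖ : v.adicCompletionIntegers K) (hϖ : Irreducible ϖ)
    (π : w.adicCompletionIntegers L) (hπ : Irreducible π) :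
    (Ideal.span {ϖ}).inertiaDeg' (Ideal.span {π}) =
      Module.finrank (IsLocalRing.ResidueField (v.adicCompletionIntegers K))
        (IsLocalRing.ResidueField (w.adicCompletionIntegers L)) := by
  rw [← hϖ.maximalIdeal_eq, ← hπ.maximalIdeal_eq]
  exact Ideal.inertiaDeg'_algebraMap _ _

/-- THE RESIDUE BRIDGE, maximal-ideal form: the inertia degree of the DVR pair `O_Kv ⊆ O_Lw` is
the global `f(w/v)`. -/
theorem inertiaDeg'_maximalIdeal_eq :
    (IsLocalRing.maximalIdeal (v.adicCompletionIntegers K)).inertiaDeg'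
      (IsLocalRing.maximalIdeal (w.adicCompletionIntegers L)) =
      v.asIdeal.inertiaDeg' w.asIdeal :=
  (Ideal.inertiaDeg'_algebraMap _ _).trans (finrank_residueField_eq_inertiaDeg' v w)

end InertiaDegree

section LocalDegree

/-- **THE LOCAL DEGREE FORMULA** `[L_w : K_v] = e(w/v) · f(w/v)` on Mathlib's completions of
number fields: the local fundamental identity `e_loc · f_loc = [L_w : K_v]` of
`T5RamifiedQuadraticDictionary` on the DVR pair `O_Kv ⊆ O_Lw` (`O_Lw` the integral closure of
`O_Kv` by `T5AdicCompletionIntegral`), with `e_loc = e(w/v)` and `f_loc = f(w/v)` by the two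
bridges. -/
theorem finrank_adicCompletion_eq_mul :
    Module.finrank (v.adicCompletion K) (w.adicCompletion L) =
      v.asIdeal.ramificationIdx' w.asIdeal * v.asIdeal.inertiaDeg' w.asIdeal := by
  obtain ⟨π₀, hπ₀⟩ := v.intValuation_exists_uniformizer
  obtain ⟨π, hπ⟩ := IsDiscreteValuationRing.exists_irreducible (w.adicCompletionIntegers L)
  rw [← T5RamifiedQuadraticDictionary.ramificationIdx'_mul_inertiaDeg'_eq_finrank
    (v.adicCompletionIntegers K) (v.adicCompletion K) (w.adicCompletion L)
    (w.adicCompletionIntegers L) _ (irreducible_algebraMap_global v π₀ hπ₀) π hπ,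
    ramificationIdx'_span_eq v w π₀ hπ₀ π hπ,
    inertiaDeg'_span_eq v w _ (irreducible_algebraMap_global v π₀ hπ₀) π hπ,
    finrank_residueField_eq_inertiaDeg']

/-- The local degree formula in the unprimed vocabulary `Ideal.ramificationIdx` /
`Ideal.inertiaDeg` of the prime `w.asIdeal` over `𝓞 K`. -/
theorem finrank_adicCompletion_eq_mul' :
    Module.finrank (v.adicCompletion K) (w.adicCompletion L) =
      w.asIdeal.ramificationIdx (𝓞 K) * w.asIdeal.inertiaDeg (𝓞 K) := by
  haveI : v.asIdeal.IsMaximal := v.isMaximal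
  haveI : w.asIdeal.IsMaximal := w.isMaximal
  rw [finrank_adicCompletion_eq_mul, Ideal.ramificationIdx'_eq_ramificationIdx _ _ v.ne_bot,
    Ideal.inertiaDeg'_eq_inertiaDeg]

end LocalDegree

section Inert

/-- At an inert quadratic place — `e(w/v) = 1` and `f(w/v) = 2` — the local degree is `2`. -/
theorem finrank_adicCompletion_eq_two_of_inert (he : v.asIdeal.ramificationIdx' w.asIdeal = 1)
    (hf : v.asIdeal.inertiaDeg' w.asIdeal = 2) :
    Module.finrank (v.adicCompletion K) (w.adicCompletion L) = 2 := by
  rw [finrank_adicCompletion_eq_mul v w, he, hf, one_mul]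

/-- When `e(w/v) = 1`, every uniformiser of `O_Kv` stays a uniformiser of `O_Lw`: the image of a
global uniformiser is `u · π^{e_loc} = u · π` by the ramification bridge, and any other
uniformiser of `O_Kv` is associated to it. -/
theorem irreducible_algebraMap_of_ramificationIdx'_eq_one
    (he : v.asIdeal.ramificationIdx' w.asIdeal = 1) {ϖ : v.adicCompletionIntegers K}
    (hϖ : Irreducible ϖ) :
    Irreducible (algebraMap (v.adicCompletionIntegers K) (w.adicCompletionIntegers L) ϖ) := by
  obtain ⟨π₀, hπ₀⟩ := v.intValuation_exists_uniformizer
  obtain ⟨π, hπ⟩ := IsDiscreteValuationRing.exists_irreducible (w.adicCompletionIntegers L)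
  have hϖ₀ := irreducible_algebraMap_global v π₀ hπ₀
  obtain ⟨u, hu⟩ := T5ContinuousValuationExtension.exists_unit_algebraMap_eq_mul_pow
    (algebraMap (𝓞 K) (v.adicCompletionIntegers K) π₀) hϖ₀.ne_zero π hπ
  rw [ramificationIdx'_span_eq v w π₀ hπ₀ π hπ, he, pow_one] at hu
  have h1 : Irreducible (algebraMap (v.adicCompletionIntegers K) (w.adicCompletionIntegers L)
      (algebraMap (𝓞 K) (v.adicCompletionIntegers K) π₀)) := by
    rw [hu]
    exact (irreducible_units_mul u).2 hπ
  exact ((IsDiscreteValuationRing.associated_of_irreducible _ hϖ₀ hϖ).map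
    (algebraMap (v.adicCompletionIntegers K) (w.adicCompletionIntegers L))).irreducible h1

/-- The `hunr` hypothesis of the inert-place package on the record's local fields — `𝔭 𝒪_{E_v} =
𝔭_{E_v}` for `𝒪_{E_v} = integralClosure O_Kv Lw` — from the GLOBAL `e(w/v) = 1`
(`T5InertPlaceCompletion.map_maximalIdeal_integralClosure_eq_of_irreducible`). -/
theorem map_maximalIdeal_integralClosure_eq_of_inert
    (he : v.asIdeal.ramificationIdx' w.asIdeal = 1) {ϖ : v.adicCompletionIntegers K}
    (hϖ : Irreducible ϖ) :
    haveI := T5InertPlaceCompletion.isLocalRing_integralClosure_adicCompletion v w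
    Ideal.map (algebraMap (v.adicCompletionIntegers K)
        (integralClosure (v.adicCompletionIntegers K) (w.adicCompletion L)))
      (IsLocalRing.maximalIdeal (v.adicCompletionIntegers K)) =
      IsLocalRing.maximalIdeal
        (integralClosure (v.adicCompletionIntegers K) (w.adicCompletion L)) :=
  T5InertPlaceCompletion.map_maximalIdeal_integralClosure_eq_of_irreducible v w hϖ
    (irreducible_algebraMap_of_ramificationIdx'_eq_one v w he hϖ)

/-- At an inert quadratic place `L_w / K_v` is Galois (`T5InertPlaceCompletion`). -/
theorem isGalois_adicCompletion_of_inert (he : v.asIdeal.ramificationIdx' w.asIdeal = 1)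
    (hf : v.asIdeal.inertiaDeg' w.asIdeal = 2) :
    IsGalois (v.adicCompletion K) (w.adicCompletion L) :=
  T5InertPlaceCompletion.isGalois_adicCompletion v w
    (finrank_adicCompletion_eq_two_of_inert v w he hf)

/-- At an inert quadratic place `L_w / K_v` has a non-trivial automorphism — the Galois
conjugation that the inert-place package takes as its star. -/
theorem exists_algEquiv_ne_one_of_inert (he : v.asIdeal.ramificationIdx' w.asIdeal = 1)
    (hf : v.asIdeal.inertiaDeg' w.asIdeal = 2) :
    ∃ σ : w.adicCompletion L ≃ₐ[v.adicCompletion K] w.adicCompletion L, σ ≠ 1 :=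
  T5InertPlaceCompletion.exists_algEquiv_ne_one v w
    (finrank_adicCompletion_eq_two_of_inert v w he hf)

/-- At an inert quadratic place the residue field of `O_Lw` has degree `2` over that of `O_Kv`. -/
theorem finrank_residueField_eq_two_of_inert (hf : v.asIdeal.inertiaDeg' w.asIdeal = 2) :
    Module.finrank (IsLocalRing.ResidueField (v.adicCompletionIntegers K))
      (IsLocalRing.ResidueField (w.adicCompletionIntegers L)) = 2 :=
  (finrank_residueField_eq_inertiaDeg' v w).trans hf

end Inert

end Summit.Ventures.HodgeRepro2.T5InertGlobalToLocal
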